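import Literature.MathematicalPhysics.QuantumLattice.HubbardTTPrimeFreeSeaGridCeiling
import Literature.MathematicalPhysics.QuantumLattice.HubbardTTPrimeBoxWordExtension
import Literature.Analysis.ValidatedNumerics.TrigLogTables
import HarnessLib

/-!
# Kernel-checked polarised-sea CAP rows for the `t–t'` Hubbard energy density, uniform in `U`

Family `hubbard` (topic `MathematicalPhysics/QuantumLattice`; the certificate CHECKER behind
`HubbardTTPrimeFreeSeaGridCeiling` §5, whose row adapter `TTPrimeFree.energyDensityTT'_le_of_polarizedSeaTable`
and cap plane `TTPrimeFree.energyDensityTT'_le_polarizedSea_plane` ask for enclosures of the cell averages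
`σ_M(i)` of `cos` and a chosen cell set `S`). Written for the certified fast layer of the Hubbard re-charter
(crew hubbard-fast, seat hubbard-box-p2: the open-above-`U` material boxes of the MO-S1 router carry no
informative cap beyond the certified `U`-columns; the fully polarised sea is a cap at EVERY `U ≥ 0`).

* §1 `TTPrimeFree.gridSigmaFI M i` — an enclosure of `σ_M(i) = (M/2π)(sin(2π(i+1)/M) - sin(2πi/M))` in
  the tree's kernel-evaluable fixed-point interval engine (`Literature.Analysis.ValidatedNumerics.Numerics.FI`,
  scale `2^48`: `FI.pi`, `FI.cosSin` = `CB.expI` with argument reduction and 11 Taylor terms), with its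
  inclusion theorem `mem_gridSigmaFI` (fallback `[-1, 1]` by `|σ| ≤ 1` if the engine declines).
* §2 interval sums (`sumFI`, `selSumFI`) and their inclusion theorems.
* §3 THE CERTIFICATE `polarizedPlaneCheck M t s₁ s₂ sel card A B : Bool` — data: the grid size `M`,
  the hopping `t`, a `t'`-interval `[s₁, s₂]`, the cell set `S` as a computable selector
  `sel : ℕ → ℕ → Bool` (`selGet` = a Boolean matrix, `selPocket` = every cell of row `i` outside a
  `j`-interval), its cardinality `card` and the claimed affine majorant `A + t'·B` — and its SOUNDNESS
  `energyDensityTT'_le_affine_of_polarizedPlaneCheck`: `check = true`, `0 ≤ U`, `n·M² = card`,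
  `s₁ ≤ t' ≤ s₂` ⟹ `e(t, t', U, n) ≤ A + t'·B`. The point/constant forms are the cases `s₁ = s₂` / `B = 0`.
* §4 the consumer shapes: `…_le_const_of_polarizedPlaneCheck` (a `U`-uniform, `t'`-cell-uniform constant
  cap — the `hCa/hCb` input of `energyDensityTT'_cap_Icc₃_of_affineCaps` with slope `0`) and the 3-D slab
  cap in S2-seam shape `energyDensityTT'_cap_Icc₃_of_polarizedPlaneChecks` (two density ends, convexity in
  `n` via `energyDensityTT'_le_max_of_caps_density`).

HONEST FRAMING: a one-species Slater determinant is a crude variational state (no correlation energy);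
these caps matter only where nothing better is certified (large `U`, low filling). One-body kinematics
plus Bach–Lieb–Solovej; nothing here bears on superconductivity. Everything is PROVED; no definition of a
physical object, no named fact. The rows (certificates found by the untrusted generator
`pub/hubbard-fast/hubbard-box-p2/code/polcap_emit.py`) live in the companion Summits certificate files.

## Mathlib / tree search

REUSED: `TTPrimeFree.energyDensityTT'_le_polarizedSea_plane`, `TTPrimeFree.gridSigma` (FreeSeaGridCeiling
§2/§5); the interval engine `FI.pi/mulInt/divNat/divPos/sub/add/mul/ofRat/ofInt`, `FI.cosSin`, `FI.mem_*`,
`FI.mem_trivial_of_abs_le_one` (FixedPointInterval, TrigLogTables); `Real.abs_sin_sub_sin_le`;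
`Finset.sum_filter`, `Fintype.sum_prod_type`, `Fin.sum_univ_eq_sum_range`, `Finset.card_eq_sum_ones`.
Certificate pattern (a `Bool` conjunction of `decide`s, discharged by `decide +kernel`) as in
`Literature/NumberTheory/LFunctions/ZetaArgumentCertificate.lean`.

## References

* V. Bach, E. H. Lieb, J. P. Solovej, *Generalized Hartree–Fock theory and the Hubbard model*,
  J. Stat. Phys. 76 (1994) 3–89, eq. (2c.36) (Slater determinants are variational). [cite: BachLiebSolovej1994, eq. (2c.36)]
* R. E. Moore, *Interval Analysis*, Prentice-Hall 1966, Ch. 2–4 (inclusion property of interval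
  extensions). [cite: Moore1966, §4.4]
* A. Neumaier, *Complete search in continuous global optimization and constraint satisfaction*,
  Acta Numerica 13 (2004) 271–369, §11 (rigorous bounds by directed rounding / interval evaluation).
  [cite: Neumaier2004CompleteSearch, §11]
-/

open Finset

namespace Literature.MathematicalPhysics.QuantumLattice.TTPrimeFree

open Literature.Analysis.ValidatedNumerics.Numerics ThermodynamicLimit

/-! ### §1 Enclosures of the cell averages `σ_M(i)` -/

/-- `|σ_M(i)| ≤ 1`: the average of `cos` over a grid step (`|sin a - sin b| ≤ |a - b|`).
[cite: Moore1966, §4.4] -/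
theorem abs_gridSigma_le_one {M : ℕ} (hM : 0 < M) (i : ℕ) : |gridSigma M i| ≤ 1 := by
  have hMr : (0 : ℝ) < M := by exact_mod_cast hM
  have hπ := Real.pi_pos
  have h := Real.abs_sin_sub_sin_le (2 * Real.pi * ((i : ℝ) + 1) / M) (2 * Real.pi * (i : ℝ) / M)
  have hd : 2 * Real.pi * ((i : ℝ) + 1) / M - 2 * Real.pi * (i : ℝ) / M = 2 * Real.pi / M := by
    field_simp; ring
  rw [hd, abs_of_pos (show (0 : ℝ) < 2 * Real.pi / M by positivity)] at h
  unfold gridSigma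
  rw [abs_mul, abs_of_pos (show (0 : ℝ) < (M : ℝ) / (2 * Real.pi) by positivity)]
  calc (M : ℝ) / (2 * Real.pi) *
        |Real.sin (2 * Real.pi * ((i : ℝ) + 1) / M) - Real.sin (2 * Real.pi * (i : ℝ) / M)|
      ≤ (M : ℝ) / (2 * Real.pi) * (2 * Real.pi / M) := mul_le_mul_of_nonneg_left h (by positivity)
    _ = 1 := by field_simp

/-
KERNEL NOTE. Every enclosure below is stated for an ABSTRACT interval argument and instantiated by
plain application: a definitional unfolding of an engine expression applied to the concrete literal
`FI.pi` with free parameters (`M`, `i`) makes the kernel try to evaluate `CB.expI` symbolically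
(observed: "(kernel) deep recursion detected" on `def f M i := (FI.cosSin (angle M i)).2` followed by
`rw [f]`). Generic lemma + application never asks for such an unfolding.
-/

/-- `sin` of an interval (second component of `FI.cosSin`). [cite: Moore1966, §4.4] -/
def sinFI (Θ : FI) : FI := (FI.cosSin Θ).2

/-- Soundness of `sinFI`. [cite: Moore1966, §4.4] -/
theorem mem_sinFI {θ : ℝ} {Θ : FI} (h : FI.mem θ Θ) : FI.mem (Real.sin θ) (sinFI Θ) := by
  rw [sinFI]
  exact (FI.mem_cosSin h).2

/-- `(M (s₁ - s₀)) / (2π)` in the engine from enclosures `S₁ ∋ s₁`, `S₀ ∋ s₀`; the trivial enclosure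
`[-1, 1]` if the division is declined. [cite: Moore1966, §4.4] -/
def sigmaFI (M : ℕ) (S₁ S₀ : FI) : FI :=
  match FI.divPos ((S₁.sub S₀).mulInt (M : ℤ)) (FI.pi.mulInt 2) with
  | some K => K
  | none => ⟨-(SC : ℤ), SC⟩

/-- Soundness of `sigmaFI` for a value known to lie in `[-1, 1]`. [cite: Moore1966, §4.4] -/
theorem mem_sigmaFI {M : ℕ} {x s₁ s₀ : ℝ} {S₁ S₀ : FI} (h₁ : FI.mem s₁ S₁) (h₀ : FI.mem s₀ S₀)
    (hx : x = (M : ℝ) / (2 * Real.pi) * (s₁ - s₀)) (habs : |x| ≤ 1) : FI.mem x (sigmaFI M S₁ S₀) := by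
  unfold sigmaFI
  split
  · rename_i K hK
    have h := FI.mem_divPos hK (FI.mem_mulInt (FI.mem_sub h₁ h₀) (M : ℤ)) (FI.mem_mulInt FI.mem_pi 2)
    convert h using 1
    have hπ := Real.pi_pos.ne'
    rw [hx]; push_cast; field_simp
  · exact FI.mem_trivial_of_abs_le_one habs

/-- The grid angle `2πi/M` in the interval engine. [cite: Moore1966, §4.4] -/
def gridAngleFI (M i : ℕ) : FI := (FI.pi.mulInt (2 * (i : ℤ))).divNat M

/-- `2πi/M ∈ gridAngleFI M i`. [cite: Moore1966, §4.4] -/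
theorem mem_gridAngleFI {M : ℕ} (hM : 0 < M) (i : ℕ) :
    FI.mem (2 * Real.pi * (i : ℝ) / M) (gridAngleFI M i) := by
  have h := FI.mem_divNat (FI.mem_mulInt FI.mem_pi (2 * (i : ℤ))) hM
  rw [gridAngleFI]
  convert h using 2
  push_cast; ring

/-- `sin(2πi/M)` in the interval engine. [cite: Moore1966, §4.4] -/
def gridSinFI (M i : ℕ) : FI := sinFI (gridAngleFI M i)

/-- `sin(2πi/M) ∈ gridSinFI M i`. [cite: Moore1966, §4.4] -/
theorem mem_gridSinFI {M : ℕ} (hM : 0 < M) (i : ℕ) :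
    FI.mem (Real.sin (2 * Real.pi * (i : ℝ) / M)) (gridSinFI M i) :=
  mem_sinFI (mem_gridAngleFI hM i)

/-- **Enclosure of `σ_M(i)`**. [cite: Moore1966, §4.4] -/
def gridSigmaFI (M i : ℕ) : FI := sigmaFI M (gridSinFI M (i + 1)) (gridSinFI M i)

/-- **Soundness**: `σ_M(i) ∈ gridSigmaFI M i`. [cite: Moore1966, §4.4] -/
theorem mem_gridSigmaFI {M : ℕ} (hM : 0 < M) (i : ℕ) : FI.mem (gridSigma M i) (gridSigmaFI M i) :=
  mem_sigmaFI (mem_gridSinFI hM (i + 1)) (mem_gridSinFI hM i)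
    (by rw [gridSigma]; push_cast; ring) (abs_gridSigma_le_one hM i)

/-! ### §2 Interval sums -/

/-- `Σ_{i<n} f i` in the engine. [cite: Moore1966, §4.4] -/
def sumFI (f : ℕ → FI) : ℕ → FI
  | 0 => FI.ofInt 0
  | n + 1 => (sumFI f n).add (f n)

/-- Inclusion property of `sumFI`. [cite: Moore1966, §4.4] -/
theorem mem_sumFI {f : ℕ → FI} {x : ℕ → ℝ} :
    ∀ n : ℕ, (∀ i, i < n → FI.mem (x i) (f i)) → FI.mem (∑ i ∈ Finset.range n, x i) (sumFI f n)
  | 0, _ => by simpa [sumFI] using FI.mem_zero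
  | n + 1, h => by
    rw [Finset.sum_range_succ]
    exact FI.mem_add (mem_sumFI n fun i hi => h i (by omega)) (h n (by omega))

/-- The selected double sum `Σ_{i,j<M, sel i j} g i j` in the engine. [cite: Moore1966, §4.4] -/
def selSumFI (M : ℕ) (sel : ℕ → ℕ → Bool) (g : ℕ → ℕ → FI) : FI :=
  sumFI (fun i => sumFI (fun j => if sel i j = true then g i j else FI.ofInt 0) M) M

/-- Inclusion property of `selSumFI`. [cite: Moore1966, §4.4] -/
theorem mem_selSumFI {M : ℕ} {sel : ℕ → ℕ → Bool} {g : ℕ → ℕ → FI} {x : ℕ → ℕ → ℝ}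
    (hg : ∀ i j, i < M → j < M → FI.mem (x i j) (g i j)) :
    FI.mem (∑ i ∈ Finset.range M, ∑ j ∈ Finset.range M, if sel i j = true then x i j else 0)
      (selSumFI M sel g) := by
  refine mem_sumFI M fun i hi => mem_sumFI M fun j hj => ?_
  split
  · exact hg i j hi hj
  · exact FI.mem_zero

/-- `Σ_{i<n} f i` over `ℕ` (kernel-friendly recursion). [cite: Moore1966, §4.4] -/
def sumNat (f : ℕ → ℕ) : ℕ → ℕ
  | 0 => 0
  | n + 1 => sumNat f n + f n

/-- `sumNat f n = Σ_{i ∈ range n} f i`. [cite: Moore1966, §4.4] -/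
theorem sumNat_eq (f : ℕ → ℕ) : ∀ n, sumNat f n = ∑ i ∈ Finset.range n, f i
  | 0 => by simp [sumNat]
  | n + 1 => by rw [Finset.sum_range_succ, sumNat, sumNat_eq f n]

/-- The number of selected cells `#{(i,j) : i,j < M, sel i j}`. [cite: Moore1966, §4.4] -/
def countSel (sel : ℕ → ℕ → Bool) (M : ℕ) : ℕ :=
  sumNat (fun i => sumNat (fun j => if sel i j = true then 1 else 0) M) M

/-! ### §3 The certificate and its soundness -/

/-- Cell selector from a Boolean matrix (`false` outside the matrix). [cite: Moore1966, §4.4] -/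
def selGet (rows : List (List Bool)) (i j : ℕ) : Bool := (rows.getD i []).getD j false

/-- Cell selector "all but a pocket": row `i` selects every `j` outside `[aᵢ, bᵢ)` where
`(aᵢ, bᵢ) = ab[i]` (default `(0, 0)` = the whole row). For the `t–t'` band at `|t'| < 1/2` the optimal
polarised sea at high filling is of this shape (a hole pocket around `(π, π)`). [cite: Moore1966, §4.4] -/
def selPocket (ab : List (ℕ × ℕ)) (i j : ℕ) : Bool :=
  !(decide ((ab.getD i (0, 0)).1 ≤ j) && decide (j < (ab.getD i (0, 0)).2))

/-- Enclosure of `M² A_S = Σ_S (-2)(σᵢ + σⱼ)`. [cite: Moore1966, §4.4] -/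
def planeASum (M : ℕ) (sel : ℕ → ℕ → Bool) : FI :=
  selSumFI M sel fun i j => ((gridSigmaFI M i).add (gridSigmaFI M j)).mulInt (-2)

/-- Enclosure of `M² B_S = Σ_S (-4) σᵢ σⱼ`. [cite: Moore1966, §4.4] -/
def planeBSum (M : ℕ) (sel : ℕ → ℕ → Bool) : FI :=
  selSumFI M sel fun i j => ((gridSigmaFI M i).mul (gridSigmaFI M j)).mulInt (-4)

/-- Scaled upper end point of `t·A_S + s·(B_S - B)` from the enclosures `AF ∋ M²A_S`, `BF ∋ M²B_S`.
[cite: Moore1966, §4.4] -/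
def affineHi (M : ℕ) (t s B : ℚ) (AF BF : FI) : ℤ :=
  (((FI.ofRat t).mul (AF.divNat (M * M))).add
    ((FI.ofRat s).mul ((BF.divNat (M * M)).sub (FI.ofRat B)))).hi

/-- **THE CERTIFICATE CHECK.** The selector `sel` picks exactly `card ≤ M²` cells, and at both
ends `s = s₁, s₂` the engine's upper end point of `t·A_S + s·(B_S - B)` is at most `A` (so that
`t·A_S + s·B_S ≤ A + s·B` on `[s₁, s₂]`). The `σ`-enclosures are recomputed by the kernel (closed
terms, cached). [cite: Neumaier2004CompleteSearch, §11] -/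
def polarizedPlaneCheck (M : ℕ) (t s₁ s₂ : ℚ) (sel : ℕ → ℕ → Bool) (card : ℕ) (A B : ℚ) : Bool :=
  decide (countSel sel M = card) && decide (card ≤ M * M) &&
    decide (((affineHi M t s₁ B (planeASum M sel) (planeBSum M sel) : ℤ) : ℚ) ≤ A * SC) &&
    decide (((affineHi M t s₂ B (planeASum M sel) (planeBSum M sel) : ℤ) : ℚ) ≤ A * SC)

/-- An affine function on `[s₁, s₂]` is at most the larger of its end values. [cite: Neumaier2004CompleteSearch, §11] -/
private theorem affine_le_max_ends {a b s s₁ s₂ : ℝ} (h₁ : s₁ ≤ s) (h₂ : s ≤ s₂) :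
    a + s * b ≤ max (a + s₁ * b) (a + s₂ * b) := by
  rcases le_total 0 b with hb | hb
  · exact le_max_of_le_right (by nlinarith)
  · exact le_max_of_le_left (by nlinarith)

/-- From the scaled upper end point: `x ∈ I`, `I.hi ≤ A·2⁴⁸` (in `ℚ`) ⟹ `x ≤ A`. [cite: Moore1966, §4.4] -/
private theorem le_of_mem_of_hi_le {x : ℝ} {I : FI} {A : ℚ} (hx : FI.mem x I)
    (h : ((I.hi : ℤ) : ℚ) ≤ A * SC) : x ≤ (A : ℝ) := by
  have h1 := hx.2
  have h2 : ((I.hi : ℤ) : ℝ) ≤ (A : ℝ) * SC := by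
    have := (Rat.cast_le (K := ℝ)).2 h
    push_cast at this
    exact this
  nlinarith [SC_pos]

/-- **SOUNDNESS OF THE CERTIFICATE.** If `polarizedPlaneCheck M t s₁ s₂ sel card A B = true` then for
every `U ≥ 0`, every density `n` with `n·M² = card` and every `t' ∈ [s₁, s₂]`:
`e(t, t', U, n) ≤ A + t'·B` — the cap plane of the fully polarised grid-cell sea over the selected cells
(`energyDensityTT'_le_polarizedSea_plane`), its coefficients enclosed by the interval engine.
[cite: BachLiebSolovej1994, eq. (2c.36)] [cite: Neumaier2004CompleteSearch, §11] -/
theorem energyDensityTT'_le_affine_of_polarizedPlaneCheck {M : ℕ} (hM : 0 < M) {t s₁ s₂ : ℚ}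
    {sel : ℕ → ℕ → Bool} {card : ℕ} {A B : ℚ}
    (h : polarizedPlaneCheck M t s₁ s₂ sel card A B = true) {U : ℝ} (hU : 0 ≤ U) {n : ℝ}
    (hn : n * (M : ℝ) ^ 2 = card) {s : ℝ} (hs₁ : (s₁ : ℝ) ≤ s) (hs₂ : s ≤ (s₂ : ℝ)) :
    energyDensityTT' (t : ℝ) s U n ≤ (A : ℝ) + s * (B : ℝ) := by
  simp only [polarizedPlaneCheck, Bool.and_eq_true, decide_eq_true_eq] at h
  obtain ⟨⟨⟨hcount, hcard⟩, hA₁⟩, hA₂⟩ := h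
  have hMr : (0 : ℝ) < M := by exact_mod_cast hM
  have hM2 : (0 : ℝ) < (M : ℝ) ^ 2 := by positivity
  -- the selected cell set
  set S : Finset (Fin M × Fin M) := Finset.univ.filter fun c => sel c.1 c.2 = true with hS
  -- bridge: sums over `S` are the selected double range sums
  have bridge : ∀ (g : ℕ → ℕ → ℝ), ∑ c ∈ S, g c.1 c.2 =
      ∑ i ∈ Finset.range M, ∑ j ∈ Finset.range M, if sel i j = true then g i j else 0 := by
    intro g
    rw [hS, Finset.sum_filter, Fintype.sum_prod_type]
    rw [← Fin.sum_univ_eq_sum_range (fun i => ∑ j ∈ Finset.range M, if sel i j = true then g i j else 0)]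
    refine Finset.sum_congr rfl fun i _ => ?_
    rw [← Fin.sum_univ_eq_sum_range (fun j => if sel i j = true then g i j else 0)]
  have bridgeN : ∀ (g : ℕ → ℕ → ℕ), ∑ c ∈ S, g c.1 c.2 =
      ∑ i ∈ Finset.range M, ∑ j ∈ Finset.range M, if sel i j = true then g i j else 0 := by
    intro g
    rw [hS, Finset.sum_filter, Fintype.sum_prod_type]
    rw [← Fin.sum_univ_eq_sum_range (fun i => ∑ j ∈ Finset.range M, if sel i j = true then g i j else 0)]
    refine Finset.sum_congr rfl fun i _ => ?_
    rw [← Fin.sum_univ_eq_sum_range (fun j => if sel i j = true then g i j else 0)]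
  -- cardinality
  have hScard : S.card = card := by
    rw [← hcount, Finset.card_eq_sum_ones, countSel, sumNat_eq]
    have hb := bridgeN (fun _ _ => 1)
    beta_reduce at hb
    rw [hb]
    refine Finset.sum_congr rfl fun i _ => ?_
    rw [sumNat_eq]
  have hSle : S.card ≤ M ^ 2 := by rw [hScard, pow_two]; exact hcard
  have hn' : n = (S.card : ℝ) / (M : ℝ) ^ 2 := by
    rw [hScard, eq_div_iff hM2.ne']; exact hn
  -- the cap plane
  have hplane := energyDensityTT'_le_polarizedSea_plane (t : ℝ) s hU hM S hSle
  rw [← hn'] at hplane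
  -- enclosures of the two coefficients
  have hσ : ∀ i, i < M → FI.mem (gridSigma M i) (gridSigmaFI M i) := fun i _ => mem_gridSigmaFI hM i
  have hAsum : FI.mem (∑ c ∈ S, (-2) * (gridSigma M c.1 + gridSigma M c.2)) (planeASum M sel) := by
    rw [bridge (fun i j => (-2) * (gridSigma M i + gridSigma M j))]
    refine mem_selSumFI fun i j hi hj => ?_
    have := FI.mem_mulInt (FI.mem_add (hσ i hi) (hσ j hj)) (-2)
    convert this using 1; push_cast; ring
  have hBsum : FI.mem (∑ c ∈ S, (-4) * (gridSigma M c.1 * gridSigma M c.2)) (planeBSum M sel) := by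
    rw [bridge (fun i j => (-4) * (gridSigma M i * gridSigma M j))]
    refine mem_selSumFI fun i j hi hj => ?_
    have := FI.mem_mulInt (FI.mem_mul (hσ i hi) (hσ j hj)) (-4)
    convert this using 1; push_cast; ring
  set AS : ℝ := 1 / (M : ℝ) ^ 2 * ∑ c ∈ S, (-2) * (gridSigma M c.1 + gridSigma M c.2) with hAS
  set BS : ℝ := 1 / (M : ℝ) ^ 2 * ∑ c ∈ S, (-4) * (gridSigma M c.1 * gridSigma M c.2) with hBS
  have hMM : 0 < M * M := Nat.mul_pos hM hM
  have hA : FI.mem AS ((planeASum M sel).divNat (M * M)) := by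
    have := FI.mem_divNat hAsum hMM
    convert this using 1
    rw [hAS]; push_cast; field_simp
  have hB : FI.mem BS ((planeBSum M sel).divNat (M * M)) := by
    have := FI.mem_divNat hBsum hMM
    convert this using 1
    rw [hBS]; push_cast; field_simp
  -- the value `t·A_S + s'·(B_S - B)` at the two ends
  have hend : ∀ s' : ℚ, FI.mem ((t : ℝ) * AS + (s' : ℝ) * (BS - (B : ℝ)))
      (((FI.ofRat t).mul ((planeASum M sel).divNat (M * M))).add
        ((FI.ofRat s').mul (((planeBSum M sel).divNat (M * M)).sub (FI.ofRat B)))) := fun s' =>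
    FI.mem_add (FI.mem_mul (FI.mem_ofRat t) hA)
      (FI.mem_mul (FI.mem_ofRat s') (FI.mem_sub hB (FI.mem_ofRat B)))
  have e₁ : (t : ℝ) * AS + (s₁ : ℝ) * (BS - (B : ℝ)) ≤ A := le_of_mem_of_hi_le (hend s₁) hA₁
  have e₂ : (t : ℝ) * AS + (s₂ : ℝ) * (BS - (B : ℝ)) ≤ A := le_of_mem_of_hi_le (hend s₂) hA₂
  have emid : (t : ℝ) * AS + s * (BS - (B : ℝ)) ≤ A :=
    (affine_le_max_ends hs₁ hs₂).trans (max_le e₁ e₂)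
  calc energyDensityTT' (t : ℝ) s U n ≤ (t : ℝ) * AS + s * BS := hplane
    _ = (t : ℝ) * AS + s * (BS - (B : ℝ)) + s * (B : ℝ) := by ring
    _ ≤ (A : ℝ) + s * (B : ℝ) := by linarith

/-! ### §4 Consumer shapes -/

/-- **Constant cap** (certificate with slope `B = 0`): `e(t, t', U, n) ≤ A` for `U ≥ 0`, `n·M² = card`,
`t' ∈ [s₁, s₂]`. [cite: BachLiebSolovej1994, eq. (2c.36)] -/
theorem energyDensityTT'_le_const_of_polarizedPlaneCheck {M : ℕ} (hM : 0 < M) {t s₁ s₂ : ℚ}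
    {sel : ℕ → ℕ → Bool} {card : ℕ} {A : ℚ}
    (h : polarizedPlaneCheck M t s₁ s₂ sel card A 0 = true) {U : ℝ} (hU : 0 ≤ U) {n : ℝ}
    (hn : n * (M : ℝ) ^ 2 = card) {s : ℝ} (hs₁ : (s₁ : ℝ) ≤ s) (hs₂ : s ≤ (s₂ : ℝ)) :
    energyDensityTT' (t : ℝ) s U n ≤ (A : ℝ) := by
  have := energyDensityTT'_le_affine_of_polarizedPlaneCheck hM h hU hn hs₁ hs₂
  simpa using this

/-- **Affine cap on a `(t', U)`-rectangle** (the `hCa`/`hCb` input shape of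
`energyDensityTT'_cap_Icc₃_of_affineCaps`): from a checked certificate, for all `s ∈ [s₁, s₂]` and all
`u ∈ [U₀, U₃]` with `U₀ ≥ 0`: `e(t, s, u, n) ≤ A + s·B`. [cite: BachLiebSolovej1994, eq. (2c.36)] -/
theorem energyDensityTT'_le_affine_on_rect_of_polarizedPlaneCheck {M : ℕ} (hM : 0 < M) {t s₁ s₂ : ℚ}
    {sel : ℕ → ℕ → Bool} {card : ℕ} {A B : ℚ}
    (h : polarizedPlaneCheck M t s₁ s₂ sel card A B = true) {n : ℝ} (hn : n * (M : ℝ) ^ 2 = card)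
    {U₀ U₃ : ℝ} (hU₀ : 0 ≤ U₀) :
    ∀ s u : ℝ, (s₁ : ℝ) ≤ s → s ≤ (s₂ : ℝ) → U₀ ≤ u → u ≤ U₃ →
      energyDensityTT' (t : ℝ) s u n ≤ (A : ℝ) + s * (B : ℝ) :=
  fun _ _ hs₁ hs₂ hu _ =>
    energyDensityTT'_le_affine_of_polarizedPlaneCheck hM h (hU₀.trans hu) hn hs₁ hs₂

/-- **3-D slab cap in S2-seam shape from two checked certificates** (density ends `na ≤ nb < 2` of the
slab, the same `t'`-interval, any `U`-range above `U₀ ≥ 0`): on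
`Set.Icc ![U₀, s₁, na] ![U₃, s₂, nb]` (coordinates `(U/t, t'/t, n)`),
`e(t, θ 1, θ 0, θ 2) ≤ max (max (Aa + s₁Ba) (Aa + s₂Ba)) (max (Ab + s₁Bb) (Ab + s₂Bb))`
(convexity of `e` in the density between the ends, affinity in `t'` on each end).
[cite: BachLiebSolovej1994, eq. (2c.36)] -/
theorem energyDensityTT'_cap_Icc₃_of_polarizedPlaneChecks {Ma Mb : ℕ} (hMa : 0 < Ma) (hMb : 0 < Mb)
    {t s₁ s₂ : ℚ} {sela selb : ℕ → ℕ → Bool} {carda cardb : ℕ} {Aa Ba Ab Bb : ℚ}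
    (ha : polarizedPlaneCheck Ma t s₁ s₂ sela carda Aa Ba = true)
    (hb : polarizedPlaneCheck Mb t s₁ s₂ selb cardb Ab Bb = true)
    {na nb : ℝ} (hna0 : 0 ≤ na) (hnb2 : nb < 2)
    (hna : na * (Ma : ℝ) ^ 2 = carda) (hnb : nb * (Mb : ℝ) ^ 2 = cardb) {U₀ U₃ : ℝ} (hU₀ : 0 ≤ U₀) :
    ∀ θ ∈ Set.Icc (![U₀, s₁, na] : Fin 3 → ℝ) ![U₃, s₂, nb],
      energyDensityTT' (t : ℝ) (θ 1) (θ 0) (θ 2) ≤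
        max (max ((Aa : ℝ) + (s₁ : ℝ) * Ba) ((Aa : ℝ) + (s₂ : ℝ) * Ba))
          (max ((Ab : ℝ) + (s₁ : ℝ) * Bb) ((Ab : ℝ) + (s₂ : ℝ) * Bb)) :=
  energyDensityTT'_cap_Icc₃_of_affineCaps (t : ℝ) hU₀ hna0 hnb2
    (energyDensityTT'_le_affine_on_rect_of_polarizedPlaneCheck hMa ha hna hU₀)
    (energyDensityTT'_le_affine_on_rect_of_polarizedPlaneCheck hMb hb hnb hU₀)

/-- **3-D slab cap in S2-seam shape, constant form** (two certificates with slope `0` at the density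
ends `na ≤ nb < 2`): on `Set.Icc ![U₀, s₁, na] ![U₃, s₂, nb]`, `e(t, θ 1, θ 0, θ 2) ≤ max Aa Ab`.
[cite: BachLiebSolovej1994, eq. (2c.36)] -/
theorem energyDensityTT'_cap_Icc₃_const_of_polarizedPlaneChecks {Ma Mb : ℕ} (hMa : 0 < Ma)
    (hMb : 0 < Mb) {t s₁ s₂ : ℚ} {sela selb : ℕ → ℕ → Bool} {carda cardb : ℕ} {Aa Ab : ℚ}
    (ha : polarizedPlaneCheck Ma t s₁ s₂ sela carda Aa 0 = true)
    (hb : polarizedPlaneCheck Mb t s₁ s₂ selb cardb Ab 0 = true)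
    {na nb : ℝ} (hna0 : 0 ≤ na) (hnb2 : nb < 2)
    (hna : na * (Ma : ℝ) ^ 2 = carda) (hnb : nb * (Mb : ℝ) ^ 2 = cardb) {U₀ U₃ : ℝ} (hU₀ : 0 ≤ U₀) :
    ∀ θ ∈ Set.Icc (![U₀, s₁, na] : Fin 3 → ℝ) ![U₃, s₂, nb],
      energyDensityTT' (t : ℝ) (θ 1) (θ 0) (θ 2) ≤ max (Aa : ℝ) (Ab : ℝ) := by
  intro θ hθ
  have h := energyDensityTT'_cap_Icc₃_of_polarizedPlaneChecks hMa hMb ha hb hna0 hnb2 hna hnb hU₀ θ hθ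
  simpa using h

end Literature.MathematicalPhysics.QuantumLattice.TTPrimeFree
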